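import Literature.Analysis.FluidPDE.ExtremeGrowthBounds
import Literature.Analysis.FunctionSpaces.TorusClassicalNSGluing
import HarnessLib

/-!
# The finite-time extreme-enstrophy-growth value function and its Lu–Doering a-priori bound

Analysis/FluidPDE file, companion of `ExtremeGrowthBounds.lean`. Kang–Yun–Protas 2020 (§2,
problem (9)–(10)) and Ayala–Protas 2017 (§2) study the OPTIMISATION PROBLEM

`Φ_T(ℰ₀) := sup { ℰ(u(T)) : u a (classical) solution of unforced Navier–Stokes on 𝕋³ on [0, T],
  ℰ(u(0)) = ℰ₀ }`,   `ℰ = ½‖∇u‖₂²` (`torusEnstrophy`),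

numerically (Riemannian conjugate-gradient ascent + continuation), reporting the power law
`max_T Φ_T(ℰ₀) ≈ 0.224 ℰ₀^{1.49}` for `ℰ₀ ∈ [100, 1000]` in their units; global regularity is
equivalent to `Φ_T(ℰ₀) < ∞` for all `ℰ₀, T` (their §1). This file TYPES the value function and
proves the one rigorous a-priori statement about it that the Lu–Doering rate estimate gives: for
windows shorter than the majorant's blow-up time `t₀(ℰ₀) = 4π⁴ν³/(27ℰ₀²)`,

`Φ_T(ℰ₀) ≤ ℰ₀ / √(1 − 2 C_LD ℰ₀² T)`   (`luDoeringMajorant`),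

so every value the optimiser farm reports for `T < t₀` must lie under the majorant, and for
`T ≥ t₀` NO a-priori bound is claimed (that is the open problem).

* `Admissible d ν ℰ₀ T` — the admissible set: classical zero-mean solutions `(u, p)` of the
  unforced system on `[0, T]` with `ℰ(u 0) = ℰ₀` and positive enstrophy along the window (for
  nonzero zero-mean data positivity is automatic by backward uniqueness; it is made an explicit
  admissibility condition here because the comparison argument divides by `ℰ²`);
* `kypMaxEnstrophy d ν ℰ₀ T` — `Φ_T(ℰ₀)` as a real `⨆` over the admissible set (junk value `0`
  if the set is empty or the values are unbounded — the statements below never use the junk case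
  silently: the upper bound holds either way, the lower bound carries its `BddAbove` from the
  majorant);
* `kypMaxEnstrophy_le_luDoeringMajorant` — `Φ_T(ℰ₀) ≤ majorant` for `2 C_LD ℰ₀² T < 1`
  (conditional on the named fact `LuDoering2008_enstrophyRate_le`, via
  `torusEnstrophy_le_luDoeringMajorant`);
* `torusEnstrophy_le_kypMaxEnstrophy` — every admissible solution's `ℰ(u(T))` is `≤ Φ_T(ℰ₀)` in
  that regime (the supremum is a genuine one there).
* HORIZON DEPENDENCE (§ "Horizon" below; the optimiser farm runs one `T` per level while the
  reported law is for `max_T Φ_T(ℰ₀)`): `mem_admissible_of_le` (admissibility restricts to shorter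
  windows), `torusEnstrophy_le_kypMaxEnstrophy_of_le` (a solution admissible on `[0, T']` bounds
  `Φ_T` from below at every `0 < T ≤ T'`, given `BddAbove`), and the ONE-SIDED ENVELOPE (Danskin)
  INEQUALITY `torusEnstrophy_sub_le_kypMaxEnstrophy_sub`: if an admissible solution ATTAINS
  `Φ_{T₀}(ℰ₀)` at its time `T₀`, then `ℰ(u T) − ℰ(u T₀) ≤ Φ_T(ℰ₀) − Φ_{T₀}(ℰ₀)` for every other
  time `T` of its window — so a maximiser whose enstrophy is larger at some other time of its
  window proves `Φ_{T₀} < Φ_T` there (`kypMaxEnstrophy_lt_of_isMaxOn_lt`: `T₀` is not the optimal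
  horizon). This is the rigorous, smoothness-free half of the envelope identity
  `dΦ/dT = ℰ'(T; u*_T)/…` that the farm's horizon diagnostics use; the `BddAbove` hypothesis is
  discharged by the majorant in the Lu–Doering regime (`…_of_luDoering` versions) and is the open
  problem otherwise.

Honest framing of the programme these definitions serve: low prior, high value-of-information
experiment on Tao's machine paradigm; NOT a claim that NS blows up.
-/

noncomputable section

open MeasureTheory Set Function
open scoped InnerProductSpace RealInnerProductSpace

namespace Literature.Analysis.FluidPDE

open Literature.Analysis.FunctionSpaces

variable (d : Type*) [Fintype d] [DecidableEq d]

/-- The ADMISSIBLE SET of the finite-time extreme-growth problem at viscosity `ν`, initial enstrophy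
`ℰ₀` and window `T`: pairs `(u, p)` that are classical solutions of the unforced Navier–Stokes
system on the unit torus on `[0, T]`, with zero-mean velocity slices, `ℰ(u 0) = ℰ₀`, and positive
enstrophy on the window (Kang–Yun–Protas 2020, problem (9)–(10) with the constraint `ℰ(u₀) = ℰ₀`;
Ayala–Protas 2017, §2). [cite: KangYunProtas2020, eqs. (9)–(10)] -/
def Admissible (ν ℰ₀ T : ℝ) : Set ((ℝ → UnitAddTorus d → EuclideanSpace ℝ d) × (ℝ → UnitAddTorus d → ℝ)) :=
  {up | Torus.IsClassicalNSSolutionOn (Icc 0 T) ν 0 up.1 up.2 ∧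
    (∀ t ∈ Icc 0 T, Torus.HasZeroMean (up.1 t)) ∧ torusEnstrophy (up.1 0) = ℰ₀ ∧
    ∀ t ∈ Icc 0 T, 0 < torusEnstrophy (up.1 t)}

/-- The finite-time EXTREME-ENSTROPHY-GROWTH VALUE FUNCTION `Φ_T(ℰ₀) = sup ℰ(u(T))` over the
admissible set (Kang–Yun–Protas 2020, (9)–(10): `max_{ℰ(u₀) = ℰ₀} ℰ(T)`), as a real `iSup`
(value `0` by convention when the admissible set is empty or the values are unbounded).
[cite: KangYunProtas2020, eqs. (9)–(10)] -/
def kypMaxEnstrophy (ν ℰ₀ T : ℝ) : ℝ :=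
  ⨆ s : Admissible d ν ℰ₀ T, torusEnstrophy (s.1.1 T)

variable {d}

/-- Pointwise form: every admissible solution obeys `ℰ(u(T)) ≤ ℰ₀/√(1 − 2 C_LD ℰ₀² T)` when
`2 C_LD ℰ₀² T < 1` (Ayala–Protas 2017, eq. (2.8); from `torusEnstrophy_le_luDoeringMajorant`).
[cite: AyalaProtas2017, eq. (2.8)] -/
theorem torusEnstrophy_le_luDoeringMajorant_of_mem_admissible
    (hLD : LuDoering2008_enstrophyRate_le (d := d)) (hd : Fintype.card d = 3) {ν ℰ₀ T : ℝ}
    (hν : 0 < ν) (hT : 0 < T) (hsmall : 2 * luDoeringConst ν * ℰ₀ ^ 2 * T < 1)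
    {s : (ℝ → UnitAddTorus d → EuclideanSpace ℝ d) × (ℝ → UnitAddTorus d → ℝ)}
    (hs : s ∈ Admissible d ν ℰ₀ T) :
    torusEnstrophy (s.1 T) ≤ luDoeringMajorant ν ℰ₀ T := by
  obtain ⟨hsol, hmean, hE0, hpos⟩ := hs
  have hTmem : T ∈ Icc (0 : ℝ) T := ⟨hT.le, le_rfl⟩
  have h1 := torusEnstrophy_le_luDoeringMajorant hLD hd hν hT hsol hmean hpos hTmem
    (by simpa [hE0] using hsmall)
  simpa [hE0] using h1

/-- **A-priori bound on the value function**: for `ν > 0`, `T > 0` and `2 C_LD ℰ₀² T < 1`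
(i.e. `T < t₀(ℰ₀) = 4π⁴ν³/(27ℰ₀²)`), `Φ_T(ℰ₀) ≤ ℰ₀/√(1 − 2 C_LD ℰ₀² T)` (Ayala–Protas 2017,
eq. (2.8) and the discussion of problem (2.13); Kang–Yun–Protas 2020, §2). Conditional on the
named fact `LuDoering2008_enstrophyRate_le`; for `T ≥ t₀` nothing is claimed.
[cite: AyalaProtas2017, eq. (2.8)] -/
theorem kypMaxEnstrophy_le_luDoeringMajorant
    (hLD : LuDoering2008_enstrophyRate_le (d := d)) (hd : Fintype.card d = 3) {ν ℰ₀ T : ℝ}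
    (hν : 0 < ν) (hℰ₀ : 0 ≤ ℰ₀) (hT : 0 < T) (hsmall : 2 * luDoeringConst ν * ℰ₀ ^ 2 * T < 1) :
    kypMaxEnstrophy d ν ℰ₀ T ≤ luDoeringMajorant ν ℰ₀ T := by
  unfold kypMaxEnstrophy
  exact Real.iSup_le
    (fun s => torusEnstrophy_le_luDoeringMajorant_of_mem_admissible hLD hd hν hT hsmall s.2)
    (div_nonneg hℰ₀ (Real.sqrt_nonneg _))

/-- In the same regime the supremum is attained from below by every admissible solution:
`ℰ(u(T)) ≤ Φ_T(ℰ₀)` (the admissible values are bounded above by the majorant, so the real `iSup`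
is a genuine least upper bound). [cite: KangYunProtas2020, eqs. (9)–(10)] -/
theorem torusEnstrophy_le_kypMaxEnstrophy
    (hLD : LuDoering2008_enstrophyRate_le (d := d)) (hd : Fintype.card d = 3) {ν ℰ₀ T : ℝ}
    (hν : 0 < ν) (hT : 0 < T) (hsmall : 2 * luDoeringConst ν * ℰ₀ ^ 2 * T < 1)
    (s : Admissible d ν ℰ₀ T) :
    torusEnstrophy (s.1.1 T) ≤ kypMaxEnstrophy d ν ℰ₀ T := by
  unfold kypMaxEnstrophy
  refine le_ciSup (f := fun s' : Admissible d ν ℰ₀ T => torusEnstrophy (s'.1.1 T)) ?_ s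
  refine ⟨luDoeringMajorant ν ℰ₀ T, ?_⟩
  rintro _ ⟨s', rfl⟩
  exact torusEnstrophy_le_luDoeringMajorant_of_mem_admissible hLD hd hν hT hsmall s'.2

/-- The value function is nonnegative (enstrophies are, and the empty/unbounded junk value is `0`).
[folklore] -/
theorem kypMaxEnstrophy_nonneg (ν ℰ₀ T : ℝ) : 0 ≤ kypMaxEnstrophy d ν ℰ₀ T :=
  Real.iSup_nonneg fun s => torusEnstrophy_nonneg (s.1.1 T)

/-! ### Horizon dependence of the value function (one-sided envelope / Danskin inequality)

The admissible set shrinks the window monotonically (a classical solution on `[0, T']` restricts to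
one on `[0, T]`, `0 < T ≤ T'`, by `Torus.IsClassicalNSSolutionOn.mono` — the one-sided time
derivative within `Icc 0 T` agrees with the one within `Icc 0 T'` because closed intervals of
positive length are sets of unique differentiability). Consequently every admissible solution on a
window `[0, T']` gives a lower bound for `Φ_T` at each intermediate horizon, and a solution that
ATTAINS the supremum at one horizon `T₀` compares the value function at two horizons through its
own trajectory. No differentiability in `T` and no structure of the set of maximisers is assumed
(the smooth "envelope theorem" `dΦ/dT = ∂_T J` is NOT claimed). -/

/-- Admissibility restricts to shorter windows: a pair admissible on `[0, T']` is admissible on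
`[0, T]` for every `0 < T ≤ T'` (restriction of a classical solution in time,
`Torus.IsClassicalNSSolutionOn.mono` with `uniqueDiffOn_Icc`; the zero-mean, initial-enstrophy and
positivity clauses restrict trivially). [folklore] -/
theorem mem_admissible_of_le {ν ℰ₀ T T' : ℝ} (hT : 0 < T) (hTT' : T ≤ T')
    {s : (ℝ → UnitAddTorus d → EuclideanSpace ℝ d) × (ℝ → UnitAddTorus d → ℝ)}
    (hs : s ∈ Admissible d ν ℰ₀ T') : s ∈ Admissible d ν ℰ₀ T := by
  obtain ⟨hsol, hmean, hE0, hpos⟩ := hs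
  have hsub : Icc (0 : ℝ) T ⊆ Icc 0 T' := Icc_subset_Icc_right hTT'
  exact ⟨hsol.mono hsub (uniqueDiffOn_Icc hT), fun t ht => hmean t (hsub ht), hE0,
    fun t ht => hpos t (hsub ht)⟩

/-- A solution admissible on `[0, T']` bounds the value function from below at every intermediate
horizon: `ℰ(u T) ≤ Φ_T(ℰ₀)` for `0 < T ≤ T'`, provided the admissible values at horizon `T` are
bounded above (the real `iSup` is then a genuine supremum; without `BddAbove` — the open problem for
long windows — the junk value `0` would make the inequality false). [folklore] -/
theorem torusEnstrophy_le_kypMaxEnstrophy_of_le {ν ℰ₀ T T' : ℝ} (hT : 0 < T) (hTT' : T ≤ T')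
    {s : (ℝ → UnitAddTorus d → EuclideanSpace ℝ d) × (ℝ → UnitAddTorus d → ℝ)}
    (hs : s ∈ Admissible d ν ℰ₀ T')
    (hbdd : BddAbove (Set.range fun s' : Admissible d ν ℰ₀ T => torusEnstrophy (s'.1.1 T))) :
    torusEnstrophy (s.1 T) ≤ kypMaxEnstrophy d ν ℰ₀ T := by
  unfold kypMaxEnstrophy
  exact le_ciSup (f := fun s' : Admissible d ν ℰ₀ T => torusEnstrophy (s'.1.1 T)) hbdd
    ⟨s, mem_admissible_of_le hT hTT' hs⟩

/-- **One-sided envelope (Danskin) inequality for the horizon.** Let `(u, p)` be admissible on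
`[0, T']` and ATTAIN the value function at some horizon `T₀` of that window,
`ℰ(u T₀) = Φ_{T₀}(ℰ₀)`. Then for every horizon `0 < T ≤ T'` with bounded admissible values,
`ℰ(u T) − ℰ(u T₀) ≤ Φ_T(ℰ₀) − Φ_{T₀}(ℰ₀)`: the maximiser's own trajectory is a lower bound for the
change of the value function between horizons (both `T < T₀`, "the optimum peaked inside its
window", and `T > T₀`, "the optimum is still rising at `T₀` and continues", are covered by taking
`T'` large enough). This is the smoothness-free half of the envelope identity
`dΦ/dT = ∂_T ℰ(T; u)|_{u = u*_T}` (Danskin); equality / differentiability is not claimed.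
[folklore] -/
theorem torusEnstrophy_sub_le_kypMaxEnstrophy_sub {ν ℰ₀ T T₀ T' : ℝ} (hT : 0 < T) (hTT' : T ≤ T')
    {s : (ℝ → UnitAddTorus d → EuclideanSpace ℝ d) × (ℝ → UnitAddTorus d → ℝ)}
    (hs : s ∈ Admissible d ν ℰ₀ T')
    (hmax : torusEnstrophy (s.1 T₀) = kypMaxEnstrophy d ν ℰ₀ T₀)
    (hbdd : BddAbove (Set.range fun s' : Admissible d ν ℰ₀ T => torusEnstrophy (s'.1.1 T))) :
    torusEnstrophy (s.1 T) - torusEnstrophy (s.1 T₀) ≤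
      kypMaxEnstrophy d ν ℰ₀ T - kypMaxEnstrophy d ν ℰ₀ T₀ := by
  have h := torusEnstrophy_le_kypMaxEnstrophy_of_le hT hTT' hs hbdd
  rw [hmax]
  linarith

/-- Corollary ("`T₀` is not the optimal horizon"): if an admissible solution attains `Φ_{T₀}(ℰ₀)`
at `T₀` but has STRICTLY larger enstrophy at another time `T` of its window (`0 < T ≤ T'`, bounded
admissible values at `T`), then `Φ_{T₀}(ℰ₀) < Φ_T(ℰ₀)`. With `T < T₀` this is the "peaked inside
the window" reading, with `T > T₀` the "still rising at the horizon" reading of the optimiser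
farm's diagnostics. [folklore] -/
theorem kypMaxEnstrophy_lt_of_isMaxOn_lt {ν ℰ₀ T T₀ T' : ℝ} (hT : 0 < T) (hTT' : T ≤ T')
    {s : (ℝ → UnitAddTorus d → EuclideanSpace ℝ d) × (ℝ → UnitAddTorus d → ℝ)}
    (hs : s ∈ Admissible d ν ℰ₀ T')
    (hmax : torusEnstrophy (s.1 T₀) = kypMaxEnstrophy d ν ℰ₀ T₀)
    (hbdd : BddAbove (Set.range fun s' : Admissible d ν ℰ₀ T => torusEnstrophy (s'.1.1 T)))
    (hlt : torusEnstrophy (s.1 T₀) < torusEnstrophy (s.1 T)) :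
    kypMaxEnstrophy d ν ℰ₀ T₀ < kypMaxEnstrophy d ν ℰ₀ T := by
  have h := torusEnstrophy_sub_le_kypMaxEnstrophy_sub hT hTT' hs hmax hbdd
  linarith

/-- The admissible values at horizon `T` are bounded above (by the Lu–Doering majorant) whenever
`ν > 0`, `T > 0` and `2 C_LD ℰ₀² T < 1` — the hypothesis `BddAbove` of the horizon lemmas,
discharged in the Lu–Doering regime (conditional on the named fact
`LuDoering2008_enstrophyRate_le`). [cite: AyalaProtas2017, eq. (2.8)] -/
theorem bddAbove_range_torusEnstrophy_admissible
    (hLD : LuDoering2008_enstrophyRate_le (d := d)) (hd : Fintype.card d = 3) {ν ℰ₀ T : ℝ}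
    (hν : 0 < ν) (hT : 0 < T) (hsmall : 2 * luDoeringConst ν * ℰ₀ ^ 2 * T < 1) :
    BddAbove (Set.range fun s' : Admissible d ν ℰ₀ T => torusEnstrophy (s'.1.1 T)) := by
  refine ⟨luDoeringMajorant ν ℰ₀ T, ?_⟩
  rintro _ ⟨s', rfl⟩
  exact torusEnstrophy_le_luDoeringMajorant_of_mem_admissible hLD hd hν hT hsmall s'.2

/-- The envelope inequality in the Lu–Doering regime, with `BddAbove` discharged by the majorant:
for `ν > 0`, card `d = 3`, `0 < T ≤ T'`, `2 C_LD ℰ₀² T < 1`, an admissible solution on `[0, T']`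
attaining `Φ_{T₀}(ℰ₀)` at `T₀` satisfies `ℰ(u T) − ℰ(u T₀) ≤ Φ_T(ℰ₀) − Φ_{T₀}(ℰ₀)` (conditional
on `LuDoering2008_enstrophyRate_le`). [cite: AyalaProtas2017, eq. (2.8)] -/
theorem torusEnstrophy_sub_le_kypMaxEnstrophy_sub_of_luDoering
    (hLD : LuDoering2008_enstrophyRate_le (d := d)) (hd : Fintype.card d = 3)
    {ν ℰ₀ T T₀ T' : ℝ} (hν : 0 < ν) (hT : 0 < T) (hTT' : T ≤ T')
    (hsmall : 2 * luDoeringConst ν * ℰ₀ ^ 2 * T < 1)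
    {s : (ℝ → UnitAddTorus d → EuclideanSpace ℝ d) × (ℝ → UnitAddTorus d → ℝ)}
    (hs : s ∈ Admissible d ν ℰ₀ T')
    (hmax : torusEnstrophy (s.1 T₀) = kypMaxEnstrophy d ν ℰ₀ T₀) :
    torusEnstrophy (s.1 T) - torusEnstrophy (s.1 T₀) ≤
      kypMaxEnstrophy d ν ℰ₀ T - kypMaxEnstrophy d ν ℰ₀ T₀ :=
  torusEnstrophy_sub_le_kypMaxEnstrophy_sub hT hTT' hs hmax
    (bddAbove_range_torusEnstrophy_admissible hLD hd hν hT hsmall)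

/-! ## Restricted (e.g. symmetry-constrained) value functions

The farm's top-branch optima turn out to be invariant under a finite group `G` of box isometries
(a chiral order-8 screw group at `ℰ₀ ≥ 250`; pub-fluidc ANALYSIS-OPT §4 F-v), which suggests solving
the extreme-growth problem RESTRICTED to a subclass `C` of admissible pairs (the solutions whose
velocity slices lie in the fixed subspace of `G`) and comparing. The only rigorous relation between
the two value functions that needs no structure on `C` is the trivial one recorded here: a restricted
supremum is at most the full one (given a non-empty restricted class and a bounded full problem). That a
restricted MAXIMISER is a critical point of the full problem is Palais' principle
(`Literature.Analysis.Calculus.symmetric_criticality`), which needs the invariance of objective and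
constraint under `G` and is not a statement about values. -/

variable (d) in
/-- The extreme-growth value function RESTRICTED to a subclass `C` of velocity–pressure pairs:
`Φ_T^C(ℰ₀) = sup {ℰ(u(T)) : (u, p) admissible and (u, p) ∈ C}` (real `iSup`, value `0` on an empty or
unbounded index). [cite: KangYunProtas2020, eqs. (9)–(10) (restricted admissible set; their
'symmetric' / 'asymmetric' branches, §4)] -/
def kypMaxEnstrophyIn (ν ℰ₀ T : ℝ)
    (C : Set ((ℝ → UnitAddTorus d → EuclideanSpace ℝ d) × (ℝ → UnitAddTorus d → ℝ))) : ℝ :=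
  ⨆ s : (Admissible d ν ℰ₀ T ∩ C : Set _), torusEnstrophy (s.1.1 T)

/-- A restricted value function never exceeds the full one: `Φ_T^C(ℰ₀) ≤ Φ_T(ℰ₀)` whenever the
restricted class contains an admissible pair and the full problem is bounded.
[cite: KangYunProtas2020, §4 (the symmetric branch lies below the asymmetric one for ℰ₀ > 100)] -/
theorem kypMaxEnstrophyIn_le {ν ℰ₀ T : ℝ}
    {C : Set ((ℝ → UnitAddTorus d → EuclideanSpace ℝ d) × (ℝ → UnitAddTorus d → ℝ))}
    (hne : (Admissible d ν ℰ₀ T ∩ C).Nonempty)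
    (hbdd : BddAbove (Set.range fun s' : Admissible d ν ℰ₀ T => torusEnstrophy (s'.1.1 T))) :
    kypMaxEnstrophyIn d ν ℰ₀ T C ≤ kypMaxEnstrophy d ν ℰ₀ T := by
  have : Nonempty (Admissible d ν ℰ₀ T ∩ C : Set _) := hne.to_subtype
  unfold kypMaxEnstrophyIn kypMaxEnstrophy
  refine ciSup_le fun s => ?_
  exact le_ciSup (f := fun s' : Admissible d ν ℰ₀ T => torusEnstrophy (s'.1.1 T)) hbdd ⟨s.1, s.2.1⟩

/-- Every member of the restricted class is bounded by the restricted value function (given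
boundedness of the full problem, which bounds the restricted range too). [folklore] -/
theorem torusEnstrophy_le_kypMaxEnstrophyIn {ν ℰ₀ T : ℝ}
    {C : Set ((ℝ → UnitAddTorus d → EuclideanSpace ℝ d) × (ℝ → UnitAddTorus d → ℝ))}
    {s : (ℝ → UnitAddTorus d → EuclideanSpace ℝ d) × (ℝ → UnitAddTorus d → ℝ)}
    (hs : s ∈ Admissible d ν ℰ₀ T) (hC : s ∈ C)
    (hbdd : BddAbove (Set.range fun s' : Admissible d ν ℰ₀ T => torusEnstrophy (s'.1.1 T))) :
    torusEnstrophy (s.1 T) ≤ kypMaxEnstrophyIn d ν ℰ₀ T C := by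
  unfold kypMaxEnstrophyIn
  have hbdd' : BddAbove (Set.range fun s' : (Admissible d ν ℰ₀ T ∩ C : Set _) =>
      torusEnstrophy (s'.1.1 T)) := by
    obtain ⟨M, hM⟩ := hbdd
    refine ⟨M, ?_⟩
    rintro _ ⟨s', rfl⟩
    exact hM ⟨⟨s'.1, s'.2.1⟩, rfl⟩
  exact le_ciSup (f := fun s' : (Admissible d ν ℰ₀ T ∩ C : Set _) => torusEnstrophy (s'.1.1 T))
    hbdd' ⟨s, hs, hC⟩

/-- In the Lu–Doering regime the boundedness hypothesis is discharged by the majorant: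
`Φ_T^C(ℰ₀) ≤ Φ_T(ℰ₀) ≤ ℰ₀/√(1 − 2 C_LD ℰ₀² T)`. [cite: AyalaProtas2017, eq. (2.8)] -/
theorem kypMaxEnstrophyIn_le_of_luDoering
    (hLD : LuDoering2008_enstrophyRate_le (d := d)) (hd : Fintype.card d = 3) {ν ℰ₀ T : ℝ}
    (hν : 0 < ν) (hT : 0 < T) (hsmall : 2 * luDoeringConst ν * ℰ₀ ^ 2 * T < 1)
    {C : Set ((ℝ → UnitAddTorus d → EuclideanSpace ℝ d) × (ℝ → UnitAddTorus d → ℝ))}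
    (hne : (Admissible d ν ℰ₀ T ∩ C).Nonempty) :
    kypMaxEnstrophyIn d ν ℰ₀ T C ≤ kypMaxEnstrophy d ν ℰ₀ T :=
  kypMaxEnstrophyIn_le hne (bddAbove_range_torusEnstrophy_admissible hLD hd hν hT hsmall)


/-- MONOTONICITY of the restricted value function in the class: `C ⊆ D` gives
`Φ_T^C(ℰ₀) ≤ Φ_T^D(ℰ₀)` (given an admissible member of `C` and boundedness of the full problem).
[folklore] -/
theorem kypMaxEnstrophyIn_mono {ν ℰ₀ T : ℝ}
    {C D : Set ((ℝ → UnitAddTorus d → EuclideanSpace ℝ d) × (ℝ → UnitAddTorus d → ℝ))}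
    (hCD : C ⊆ D) (hne : (Admissible d ν ℰ₀ T ∩ C).Nonempty)
    (hbdd : BddAbove (Set.range fun s' : Admissible d ν ℰ₀ T => torusEnstrophy (s'.1.1 T))) :
    kypMaxEnstrophyIn d ν ℰ₀ T C ≤ kypMaxEnstrophyIn d ν ℰ₀ T D := by
  have : Nonempty (Admissible d ν ℰ₀ T ∩ C : Set _) := hne.to_subtype
  show (⨆ s : (Admissible d ν ℰ₀ T ∩ C : Set _), torusEnstrophy (s.1.1 T)) ≤ _
  refine ciSup_le fun s => ?_
  exact torusEnstrophy_le_kypMaxEnstrophyIn s.2.1 (hCD s.2.2) hbdd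

/-- ATTAINMENT TRANSFERS THE VALUE: if some member `s` of the restricted class `C` is admissible and
already reaches the FULL value, `Φ_T(ℰ₀) ≤ ℰ(s(T))`, then the restricted and the full value functions
coincide, `Φ_T^C(ℰ₀) = Φ_T(ℰ₀)`.  This is the shape in which a symmetric extreme state is reported:
a maximiser lying in the fixed subspace of a symmetry group `G` makes the `G`-restricted problem
as extreme as the unrestricted one (the numerics can only ever suggest the hypothesis, never prove it).
[folklore] -/
theorem kypMaxEnstrophyIn_eq_of_attained {ν ℰ₀ T : ℝ}
    {C : Set ((ℝ → UnitAddTorus d → EuclideanSpace ℝ d) × (ℝ → UnitAddTorus d → ℝ))}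
    {s : (ℝ → UnitAddTorus d → EuclideanSpace ℝ d) × (ℝ → UnitAddTorus d → ℝ)}
    (hs : s ∈ Admissible d ν ℰ₀ T) (hC : s ∈ C)
    (hbdd : BddAbove (Set.range fun s' : Admissible d ν ℰ₀ T => torusEnstrophy (s'.1.1 T)))
    (hmax : kypMaxEnstrophy d ν ℰ₀ T ≤ torusEnstrophy (s.1 T)) :
    kypMaxEnstrophyIn d ν ℰ₀ T C = kypMaxEnstrophy d ν ℰ₀ T :=
  le_antisymm (kypMaxEnstrophyIn_le ⟨s, hs, hC⟩ hbdd)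
    (hmax.trans (torusEnstrophy_le_kypMaxEnstrophyIn hs hC hbdd))

/-- … and then `s` is a maximiser of BOTH problems: `ℰ(s(T)) = Φ_T^C(ℰ₀) = Φ_T(ℰ₀)`. [folklore] -/
theorem torusEnstrophy_eq_kypMaxEnstrophy_of_attained {ν ℰ₀ T : ℝ}
    {s : (ℝ → UnitAddTorus d → EuclideanSpace ℝ d) × (ℝ → UnitAddTorus d → ℝ)}
    (hs : s ∈ Admissible d ν ℰ₀ T)
    (hbdd : BddAbove (Set.range fun s' : Admissible d ν ℰ₀ T => torusEnstrophy (s'.1.1 T)))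
    (hmax : kypMaxEnstrophy d ν ℰ₀ T ≤ torusEnstrophy (s.1 T)) :
    torusEnstrophy (s.1 T) = kypMaxEnstrophy d ν ℰ₀ T := by
  refine le_antisymm ?_ hmax
  unfold kypMaxEnstrophy
  exact le_ciSup (f := fun s' : Admissible d ν ℰ₀ T => torusEnstrophy (s'.1.1 T)) hbdd ⟨s, hs⟩

end Literature.Analysis.FluidPDE
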